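import Literature.AlgebraicGeometry.Resolution.AlterationsFibrationReductionSection
import Literature.AlgebraicGeometry.Resolution.ZariskiSections
import Literature.AlgebraicGeometry.Resolution.GaloisNormalizationHolds
import Literature.AlgebraicGeometry.Resolution.AlterationsNodeLocalStructureProofs
import Literature.AlgebraicGeometry.Resolution.AlterationsRationalMapExtensionProofs
import Literature.AlgebraicGeometry.Resolution.RelativeDimensionCurve
import Literature.AlgebraicGeometry.Resolution.AlterationsStrictTransformProofs
import Literature.AlgebraicGeometry.Resolution.SemiStableFibreBranches
import Literature.Topology.KrullDimensionDrop
import Mathlib.AlgebraicGeometry.AlgClosed.Basic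
import Mathlib.AlgebraicGeometry.PullbackCarrier
import HarnessLib

/-!
# De Jong 1996, 4.11–4.12 with Zariski's connectedness PROVED: Thm. 4.1 from SIX open leaves

Topic: `Literature/AlgebraicGeometry/Resolution`. Pure proofs, no definitions beyond the
statements, no named facts. In 4.12 (p. 69) de Jong concludes "hence all fibres of `f` are
geometrically connected" from the Stein factorisation `X' → Y' → ℙ^{d-1}` of the pencil
fibration `f` of Lemma 4.11 and Zariski's connectedness theorem (EGA III₁ 4.3.1 / Stacks 03H2).
The tree carried the latter as the named fact `Morphisms.steinFactorization_geometricallyConnected`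
— Stacks 03H2 for ARBITRARY proper morphisms, i.e. the coherence theorem, which nobody can
discharge. This file removes it from the trust base of Thm. 4.1: for the CONSTRUCTED
`f = pr_p ∘ pr₂ : X' = X ×_{ℙ^d} P̃ → ℙ^{d-1}` (blow-up `P̃` of the vertex, `X` normal) the
geometric connectedness of all fibres is PROVED
(`DeJong1996.geometricallyConnected_construction_zariski`) from the form of Zariski's theorem
proved in `ZariskiSections.lean` (degeneration along a discrete valuation ring for the flat
projective closure of the generic fibre, where the theorem on formal functions IS available,
`Morphisms.hasSurjectiveFormalFunctions_of_finite_cechH1`), whose hypotheses are checked here: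

* `f_* 𝒪_{X'} = 𝒪` (`bijective_app_of_isIso_fromNormalization`): the section of `f` through the
  exceptional divisor makes `f.fromNormalization` an isomorphism (`AlterationsFibrationReductionSection`);
* local sections of `f` through EVERY irreducible component of EVERY fibre
  (`DeJong1996.exists_section_apply_mem_component`): a component `C` of `f⁻¹(ℓ) ≅ π⁻¹(ℓ)` has
  dimension `1` (Lemma 4.11 (ii) b)) and `pr₂` is finite, so `pr₂(C)` is the whole line `ℓ`
  (`exists_mem_component_apply_fiberι_eq`: incomparability and the dimension drop for proper
  closed subsets, `Literature/Topology/KrullDimensionDrop`), in particular `C` has a point `c` over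
  the point `e = sᵢ(ℓ)` of `E`; `x = pr₁(c)` is a closed point of `X` over the vertex `p`, a
  `k`-point (Nullstellensatz, Mathlib `pointOfClosedPoint`), and the section `(x, sᵢ)` of `f` over
  the chart `D₊(yᵢ)` passes through `c` — the point of `X ×_{ℙ^d} P̃` over `(x, e)` being unique
  as `κ(p) = κ(x) = k` (`Scheme.Pullback.eq_of_fst_eq_of_snd_eq`, Stacks 01JT);
* a discrete valuation ring through every point of `ℙ^{d-1}` and the generic point
  (`ZariskiSections.exists_dvr_through_point_projectiveSpace`), and `X'` projective over `k`
  (blow-ups are projective, `BlowupProjectiveOverField_holds`).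

Consequences: `DeJong1996FibrationReduction.of_vertexChoice` — 4.11–4.12
(`DeJong1996FibrationReduction`) from the generic choice of `π` and `p`
(`DeJong1996Lemma411VertexChoice`: 2.11 and Bertini) ALONE; and, with 4.16 and 2.23/3.3
discharged (`DeJong1996GaloisNormalization_holds`, `DeJong1996NodeLocalStructure_holds`) and
4.18–4.21 reduced to Raynaud–Gruson's flattening theorem
(`DeJong1996RationalMapExtension.of_stacks081R`), **de Jong's Thm. 4.1 in all its forms from SIX
open named facts** (`DeJong1996Strong.of_openLeaves₆`): `DeJong1996Lemma411VertexChoice`,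
`DeJong1996MultisectionHyperplane`, `DeJong1996StableExtension`, `Stacks081R`,
`DeJong1996NodeLocalStructureCodimTwo`, `DeJong1996SemiStableCodimTwoBlowupCore`.

## Sources

* A. J. de Jong, *Smoothness, semi-stability and alterations*, Publ. Math. IHÉS 83 (1996)
  51–93: Lemma 4.11 and 4.12, pp. 67–69; Thm. 4.1, p. 66. [DeJong1996]
* A. Grothendieck, EGA III₁ 4.3.1; The Stacks Project, Tags 03H0/03H2 (Zariski's connectedness
  theorem), 04KV, 01JT, 00GT. [StacksProject]
-/

noncomputable section

open CategoryTheory CategoryTheory.Limits AlgebraicGeometry TopologicalSpace Topology HomogeneousLocalization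

attribute [local instance] MvPolynomial.gradedAlgebra
  Literature.AlgebraicGeometry.Motives.ProjBaseChange.algebraBase
  Literature.AlgebraicGeometry.Motives.ProjBaseChange.isScalarTower_localization

namespace Literature.AlgebraicGeometry.Resolution

universe u

open Literature.AlgebraicGeometry.Motives (projectiveSpace IsProjectiveOver projectiveSpace_hom_eq_toSpec)
open Literature.AlgebraicGeometry.Motives.Segre (grading chartι toSpec)
open Literature.AlgebraicGeometry.Morphisms

/-! ## Points of a fibre product over a point with trivial residue field extension -/

/-- **A fibre product has at most one point over `(x, y)` when `κ(f x) → κ(x)` is onto**: the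
points of `X ×_S Y` over `x`, `y` are the primes of `κ(x) ⊗_{κ(s)} κ(y)` (Mathlib
`Scheme.Pullback.carrierEquiv`), and if `κ(s) → κ(x)` is an isomorphism this ring is the field
`κ(y)`. [cite: StacksProject, Tag 01JT] -/
theorem Scheme.Pullback.eq_of_fst_eq_of_snd_eq {X Y S : Scheme.{u}} {f : X ⟶ S} {g : Y ⟶ S}
    {z z' : ↥(pullback f g)} (h₁ : pullback.fst f g z = pullback.fst f g z')
    (h₂ : pullback.snd f g z = pullback.snd f g z')
    (hs : Function.Surjective (f.residueFieldMap (pullback.fst f g z'))) : z = z' := by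
  apply Scheme.Pullback.carrierEquiv.injective
  rw [Scheme.Pullback.carrierEquiv_eq_iff]
  have hT : Scheme.Pullback.Triplet.ofPoint z = Scheme.Pullback.Triplet.ofPoint z' :=
    Scheme.Pullback.Triplet.ext h₁ h₂
  refine ⟨hT, ?_⟩
  -- `κ(x') ⊗_{κ(s)} κ(y')` is the field `κ(y')`
  set T := Scheme.Pullback.Triplet.ofPoint z' with hTdef
  haveI : IsIso ((S.residueFieldCongr T.hx).inv ≫ f.residueFieldMap T.x) := by
    refine (ConcreteCategory.isIso_iff_bijective _).mpr ⟨?_, ?_⟩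
    · exact ((S.residueFieldCongr T.hx).inv ≫ f.residueFieldMap T.x).hom.injective
    · change Function.Surjective ((f.residueFieldMap T.x).hom ∘ (S.residueFieldCongr T.hx).inv.hom)
      exact hs.comp (S.residueFieldCongr T.hx).symm.commRingCatIsoToRingEquiv.surjective
  haveI : IsIso T.tensorInr := by
    delta Scheme.Pullback.Triplet.tensorInr Scheme.Pullback.Triplet.tensor
    infer_instance
  have hsub : Subsingleton ↥(Spec T.tensor) := by
    haveI : Subsingleton ↥(Spec (Y.residueField T.y)) :=
      inferInstanceAs (Subsingleton (PrimeSpectrum (Y.residueField T.y)))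
    exact (Scheme.homeoOfIso (asIso (Spec.map T.tensorInr))).injective.subsingleton
  exact Subsingleton.elim (h := hsub) _ _

/-! ## Residue fields of closed points over an algebraically closed field -/

/-- **Over an algebraically closed field, `κ(π x) → κ(x)` is onto for closed points.** For a
`k`-morphism `π : X → Y` of schemes locally of finite type over the algebraically closed field
`k`, a closed point `x ∈ X` with `π x` closed: both residue fields are `k` (Mathlib
`residueFieldIsoBase`, Hilbert's Nullstellensatz) compatibly with `π` (the `k`-points
`Spec k → X → Y` and `Spec k → Y` through `π x` coincide, Mathlib `ext_of_apply_closedPoint_eq`).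
[folklore] -/
theorem surjective_residueFieldMap_of_isClosed {k : Type u} [Field k] [IsAlgClosed k]
    {X Y : Scheme.{u}} (π : X ⟶ Y) (pX : X ⟶ Spec (.of k)) (pY : Y ⟶ Spec (.of k))
    [LocallyOfFiniteType pX] [LocallyOfFiniteType pY] (hπ : π ≫ pY = pX) (x : X)
    (hx : IsClosed ({x} : Set X)) (hy : IsClosed ({π x} : Set Y)) :
    Function.Surjective (π.residueFieldMap x) := by
  set eX := residueFieldIsoBase pX x hx with heX
  set eY := residueFieldIsoBase pY (π x) hy with heY
  -- the two `k`-points of `Y` at `π x` agree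
  have hab : pointOfClosedPoint pX x hx ≫ π = pointOfClosedPoint pY (π x) hy := by
    apply ext_of_apply_closedPoint_eq pY
    · rw [Category.assoc, hπ, pointOfClosedPoint_comp]
    · exact pointOfClosedPoint_comp _ _ _
    · rw [Scheme.Hom.comp_apply, pointOfClosedPoint_apply, pointOfClosedPoint_apply]
  have key : π.residueFieldMap x ≫ eX.hom = eY.hom := by
    apply Spec.map_injective
    rw [← cancel_mono (Y.fromSpecResidueField (π x)), Spec.map_comp, Category.assoc,
      Scheme.Hom.SpecMap_residueFieldMap_fromSpecResidueField]
    exact hab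
  have e : π.residueFieldMap x = eY.hom ≫ eX.inv := by
    rw [← key, Category.assoc, Iso.hom_inv_id, Category.comp_id]
  rw [e]
  exact (ConcreteCategory.bijective_of_isIso (eY.hom ≫ eX.inv)).2

/-! ## `f_* 𝒪_X = 𝒪_S` from the Stein factorisation being trivial -/

/-- If `f.fromNormalization` is an isomorphism (and `f` is universally closed and
quasi-separated), then `Γ(V, 𝒪_S) → Γ(f⁻¹V, 𝒪_X)` is bijective for every affine open `V`
(`Morphisms.isIso_toNormalization_app`: `f = f' ≫ π` with `f'^♯` an isomorphism over affines).
[cite: StacksProject, Tag 03GY] -/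
theorem bijective_app_of_isIso_fromNormalization {X S : Scheme.{u}} (f : X ⟶ S)
    [QuasiSeparated f] [UniversallyClosed f] [IsIso f.fromNormalization] (V : S.Opens)
    (hV : IsAffineOpen V) : Function.Bijective (f.app V) := by
  have h2 : IsIso (f.toNormalization.app (f.fromNormalization ⁻¹ᵁ V)) :=
    isIso_toNormalization_app f ⟨V, hV⟩
  have e := Scheme.Hom.congr_app (f.toNormalization_fromNormalization).symm V
  rw [Scheme.Hom.comp_app] at e
  have h1 : IsIso (f.fromNormalization.app V) := inferInstance
  have hAB : IsIso (f.fromNormalization.app V ≫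
      f.toNormalization.app (f.fromNormalization ⁻¹ᵁ V)) :=
    @IsIso.comp_isIso _ _ _ _ _ _ _ h1 h2
  have : IsIso (f.app V) := by
    rw [e]
    exact @IsIso.comp_isIso _ _ _ _ _ _ _ hAB inferInstance
  exact ConcreteCategory.bijective_of_isIso (f.app V)

/-! ## Components of the fibres of `f = q ∘ p` map onto the fibres of `q` -/

/-- **Irreducible components of dimension `1` of the fibres of `f = q ∘ p`, `p` finite, map ONTO
the (irreducible, at most one-dimensional) fibres of `q`.** A component `C` of `f⁻¹(y)` of
dimension `1` has closed irreducible image `p(C) ⊆ q⁻¹(y)` of dimension `≥ 1` (incomparability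
for the finite `p`, `Literature.Topology.topologicalKrullDim_le_rangeFactorization`), and
`q⁻¹(y)` is irreducible of dimension `≤ 1`, so `p(C) = q⁻¹(y)`
(`Literature.Topology.topologicalKrullDim_lt_of_isClosed_ssubset`): `C` contains a point over
any given point `e` of `q⁻¹(y)`. (De Jong 1996, 4.11–4.12, for `f = pr_p ∘ pr₂` on
`X ×_{ℙ^{d}} P̃`: every component of `f⁻¹(ℓ) = π⁻¹(ℓ)` maps onto the line `ℓ`.)
[cite: DeJong1996, Lemma 4.11 (ii) b) and 4.12, pp. 67–69] -/
theorem exists_mem_component_apply_fiberι_eq {X' P S : Scheme.{u}} (p : X' ⟶ P) [IsFinite p]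
    (q : P ⟶ S) (f : X' ⟶ S) (hf : f = p ≫ q) (y : S) (hirr : IrreducibleSpace ↥(q.fiber y))
    (hq : topologicalKrullDim ↥(q.fiber y) ≤ 1) {C : Set ↥(f.fiber y)}
    (hC : C ∈ irreducibleComponents ↥(f.fiber y)) (hdim : topologicalKrullDim ↥C = 1)
    (e : P) (he : q e = y) : ∃ c ∈ C, p (f.fiberι y c) = e := by
  -- the finite comparison map of fibres `m : f⁻¹(y) → q⁻¹(y)`
  let m : f.fiber y ⟶ q.fiber y :=
    pullback.map f (S.fromSpecResidueField y) q (S.fromSpecResidueField y) p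
      (𝟙 _) (𝟙 _) ((Category.comp_id _).trans hf) ((Category.comp_id _).trans (Category.id_comp _).symm)
  haveI : IsFinite m :=
    MorphismProperty.pullbackMap (P := @IsFinite) inferInstance inferInstance hf (Category.id_comp _).symm
  haveI := hirr
  have hmι : m ≫ q.fiberι y = f.fiberι y ≫ p := pullback.lift_fst _ _ _
  -- `p(C)`, as the range of `m|_C`
  let mc : ↥C → ↥(q.fiber y) := fun c => m c.1
  have hmc : Continuous mc := m.continuous.comp continuous_subtype_val
  have hCcl : IsClosed C := isClosed_of_mem_irreducibleComponents C hC
  have hrange : IsClosed (Set.range mc) := by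
    have : Set.range mc = m '' C := by
      ext t
      simp only [Set.mem_range, Set.mem_image, Subtype.exists, exists_prop, mc]
    rw [this]
    exact m.isClosedMap C hCcl
  haveI : QuasiSober ↥C := Literature.Topology.quasiSober_of_isClosed hCcl
  have hinc : ∀ ⦃a c : ↥C⦄, a ⤳ c → mc a = mc c → a = c := by
    intro a c hac hm
    apply Subtype.ext
    exact eq_of_specializes_of_isIntegralHom m ((subtype_specializes_iff a c).mp hac) hm
  have h1 : (1 : WithBot ℕ∞) ≤ topologicalKrullDim ↥(Set.range mc) := by
    rw [← hdim]
    exact Literature.Topology.topologicalKrullDim_le_rangeFactorization hmc hrange hinc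
  -- `q⁻¹(y)` is irreducible of dimension `≤ 1`, so `p(C)` is everything
  have huniv : Set.range mc = Set.univ := by
    by_contra hne
    have hlt := Literature.Topology.topologicalKrullDim_lt_of_isClosed_ssubset hrange hne 1
      (lt_of_le_of_lt hq (by decide))
    exact absurd (lt_of_le_of_lt h1 hlt) (lt_irrefl _)
  -- the point of `q.fiber y` over `e`
  have he' : e ∈ q ⁻¹' {y} := he
  obtain ⟨⟨c, hcC⟩, hc⟩ : (q.fiberHomeo y).symm ⟨e, he'⟩ ∈ Set.range mc := by
    rw [huniv]; trivial
  refine ⟨c, hcC, ?_⟩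
  have : q.fiberι y (m c) = e := by
    change q.fiberι y (mc ⟨c, hcC⟩) = e
    rw [hc, Scheme.Hom.fiberι_fiberHomeo_symm]
  rw [← this, ← Scheme.Hom.comp_apply, ← hmι, Scheme.Hom.comp_apply]


/-! ## Local sections of `f = q ∘ pr₂` through every component of every fibre -/

/-- Every point of `ℙ^d = Proj k[y₀, …, y_d]` lies in the range of a standard chart.
[folklore] -/
theorem exists_mem_range_chartι {k : Type u} [Field k] {d : ℕ} (y : Proj (grading (Fin (d + 1)) k)) :
    ∃ i : Fin (d + 1), y ∈ Set.range (chartι k i) := by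
  have htop := Proj.iSup_basicOpen_eq_top (grading (Fin (d + 1)) k)
    (MvPolynomial.X : Fin (d + 1) → MvPolynomial (Fin (d + 1)) k)
    (Motives.ProjectiveSpace.irrelevant_le_span d k)
  have hy : y ∈ (⨆ i, Proj.basicOpen (grading (Fin (d + 1)) k)
      (MvPolynomial.X i : MvPolynomial (Fin (d + 1)) k)) := by
    rw [htop]; trivial
  obtain ⟨i, hi⟩ := TopologicalSpace.Opens.mem_iSup.mp hy
  refine ⟨i, ?_⟩
  rw [← Scheme.Hom.coe_opensRange, Proj.opensRange_awayι]
  exact hi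

namespace DeJong1996

variable {k : Type u} [Field k] [IsAlgClosed k] {X : Scheme.{u}} {fX : X ⟶ Spec (.of k)} {Z : Set X}
  {d : ℕ} {π : X ⟶ (projectiveSpace (d + 1) k).left}

/-- **A `k`-point of `X` through a given closed point over the vertex** (variant of
`exists_point_over_vertexPt` with prescribed image): a closed point of the finite fibre
`X ×_{ℙ^{d+1}} Spec k` over the given point gives, by the Nullstellensatz (Mathlib
`pointOfClosedPoint`), a `k`-point of `X` over the `k`-point at the vertex.
[cite: DeJong1996, 4.12, p. 68] -/
theorem exists_point_over_vertexPt_apply_eq (hπ : Lemma411Projection fX Z d π (vertex d k))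
    {P : Scheme.{u}} {b : P ⟶ Proj (grading (Fin (d + 1 + 1)) k)}
    (hb : IsBlowup b (vertexIdealSheaf d k)) {x : X} (hx : π x = vertex d k)
    (hxc : IsClosed ({x} : Set X)) :
    ∃ x₀ : Spec (.of k) ⟶ X, x₀ ≫ π = vertexPt d k ∧ ∀ a, x₀ a = x := by
  haveI := hπ.isFinite
  let F := pullback π (vertexPt d k)
  let pt : Spec (.of k) := IsLocalRing.closedPoint k
  have hx' : π x = vertexPt d k pt := by rw [hx, vertexPt_apply hb]
  obtain ⟨z, hz, -⟩ := Scheme.Pullback.exists_preimage_pullback (f := π) (g := vertexPt d k) x pt hx'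
  haveI : CompactSpace F := QuasiCompact.compactSpace_of_compactSpace (pullback.snd π (vertexPt d k))
  obtain ⟨z₀, hz₀cl, hz₀⟩ := (isClosed_closure (s := ({z} : Set F))).exists_closed_singleton
    ⟨z, subset_closure rfl⟩
  have hfz₀ : pullback.fst π (vertexPt d k) z₀ = x := by
    have h := image_closure_subset_closure_image (pullback.fst π (vertexPt d k)).continuous
      ⟨z₀, hz₀cl, rfl⟩
    rw [Set.image_singleton, hz, hxc.closure_eq] at h
    exact h
  refine ⟨pointOfClosedPoint (pullback.snd π (vertexPt d k)) z₀ hz₀ ≫ pullback.fst π (vertexPt d k),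
    ?_, fun a => ?_⟩
  · rw [Category.assoc, pullback.condition, ← Category.assoc, pointOfClosedPoint_comp, Category.id_comp]
  · rw [Scheme.Hom.comp_apply, pointOfClosedPoint_apply, hfz₀]

/-- **Through every irreducible component of every fibre of `f = q ∘ pr₂` passes a local section
of `f`.** For `y` in the chart `D₊(yᵢ)` and a component `C` of `f⁻¹(y)`: `C` contains a point
`c` over the point `e = sᵢ(y)` of the exceptional divisor (`exists_mem_component_apply_fiberι_eq`);
`x = pr₁(c)` is a closed point of `X` over the vertex, hence a `k`-point `x₀`
(`exists_point_over_vertexPt_apply_eq`); the section `(x₀, sᵢ) : D₊(yᵢ) → X ×_{ℙ^{d+1}} P̃`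
of `f` takes at `y` the unique value over `(x, e)` (`Scheme.Pullback.eq_of_fst_eq_of_snd_eq`,
`κ(vertex) = κ(x) = k`), namely `c ∈ C`. [cite: DeJong1996, 4.12, pp. 68–69] -/
theorem exists_section_apply_mem_component (hπ : Lemma411Projection fX Z d π (vertex d k))
    [LocallyOfFiniteType fX] {P : Scheme.{u}} {b : P ⟶ Proj (grading (Fin (d + 1 + 1)) k)}
    [IsIntegral P] [IsDominant b] (hb : IsBlowup b (vertexIdealSheaf d k))
    (hdim : ∀ (y : Proj (grading (Fin (d + 1)) k)), ∀ C ∈ irreducibleComponents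
      ↥((pullback.snd π b ≫ vertexBlowupProjection b hb).fiber y), topologicalKrullDim ↥C = 1)
    (y : Proj (grading (Fin (d + 1)) k))
    {C : Set ↥((pullback.snd π b ≫ vertexBlowupProjection b hb) ⁻¹' {y})}
    (hC : C ∈ irreducibleComponents ↥((pullback.snd π b ≫ vertexBlowupProjection b hb) ⁻¹' {y})) :
    ∃ (V : (Proj (grading (Fin (d + 1)) k)).Opens) (hy : y ∈ V)
      (σ : (V : Scheme.{u}) ⟶ pullback π b),
      σ ≫ (pullback.snd π b ≫ vertexBlowupProjection b hb) = V.ι ∧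
        σ ⟨y, hy⟩ ∈ Subtype.val '' C := by
  haveI := hπ.isFinite
  haveI : IsFinite (pullback.snd π b) := MorphismProperty.pullback_snd _ _ inferInstance
  have hM := pointBlowupProjection_vertexBlowupProjection b hb
  -- the chart `D₊(yᵢ) ∋ y` and the point `y'` of `Spec (k[y]_{(yᵢ)})₀` over `y`
  obtain ⟨i, hyi⟩ := exists_mem_range_chartι y
  have hyV : y ∈ (chartι k i).opensRange := hyi
  set y' := (chartι k i).isoOpensRange.inv ⟨y, hyV⟩ with hy'def
  have hy' : chartι k i y' = y := by
    rw [hy'def, ← Scheme.Hom.comp_apply, Scheme.Hom.isoOpensRange_inv_comp]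
    rfl
  -- the point `e` of the exceptional divisor over `y`
  set e := vertexChartSection hb i y' with hedef
  have he : vertexBlowupProjection b hb e = y := by
    rw [hedef, ← Scheme.Hom.comp_apply, vertexChartSection_comp_projection, hy']
  -- a point `c ∈ C` over `e`
  have hC' := (StrictTransform.topologicalKrullDim_image_of_mem_irreducibleComponents
    ((pullback.snd π b ≫ vertexBlowupProjection b hb).fiberHomeo y).symm hC).1
  obtain ⟨c', hc'C', hc'⟩ := exists_mem_component_apply_fiberι_eq (pullback.snd π b)
    (vertexBlowupProjection b hb) (pullback.snd π b ≫ vertexBlowupProjection b hb) rfl y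
    (hM.irreducibleSpace_fiber y) (hM.topologicalKrullDim_fiber_le_one y) hC' (hdim y _ hC') e he
  set c := (pullback.snd π b ≫ vertexBlowupProjection b hb).fiberι y c' with hcdef
  have hcC : c ∈ Subtype.val '' C := by
    obtain ⟨c₀, hc₀, rfl⟩ := hc'C'
    refine ⟨c₀, hc₀, ?_⟩
    rw [hcdef, Scheme.Hom.fiberι_fiberHomeo_symm]
  -- `x = pr₁ c` is a closed point over the vertex, hence a `k`-point `x₀`
  set x := pullback.fst π b c with hxdef
  have hxv : π x = vertex d k := by
    rw [hxdef, ← Scheme.Hom.comp_apply, pullback.condition, Scheme.Hom.comp_apply]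
    change b (pullback.snd π b c) = vertex d k
    rw [hc']
    exact apply_vertexChartSection hb i y'
  have hvc : IsClosed ({vertex d k} : Set (Proj (grading (Fin (d + 1 + 1)) k))) := hM.isClosed_singleton
  have hxc : IsClosed ({x} : Set X) :=
    isClosed_singleton_of_isIntegralHom π (by rw [hxv]; exact hvc)
  obtain ⟨x₀, hx₀π, hx₀x⟩ := exists_point_over_vertexPt_apply_eq hπ hb hxv hxc
  -- the section `(x₀, sᵢ)`
  let σ' : Spec (.of (Away (grading (Fin (d + 1)) k) (MvPolynomial.X i))) ⟶ pullback π b :=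
    pullback.lift (Spec.map (CommRingCat.ofHom (algebraMap k _)) ≫ x₀) (vertexChartSection hb i) (by
      rw [Category.assoc, hx₀π]
      exact (vertexChartSection_comp hb i).symm)
  refine ⟨(chartι k i).opensRange, hyV, (chartι k i).isoOpensRange.inv ≫ σ', ?_, ?_⟩
  · rw [Category.assoc, pullback.lift_snd_assoc, vertexChartSection_comp_projection,
      Scheme.Hom.isoOpensRange_inv_comp]
  · -- its value at `y` is `c`
    rw [Scheme.Hom.comp_apply, ← hy'def]
    have hval : σ' y' = c := by
      haveI : IsProper (projectiveSpace (d + 1) k).hom :=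
        Motives.IsProjectiveOver.isProper (isProjectiveOver_projectiveSpace (d + 1) k)
      refine Scheme.Pullback.eq_of_fst_eq_of_snd_eq ?_ ?_ ?_
      · rw [← Scheme.Hom.comp_apply, pullback.lift_fst, Scheme.Hom.comp_apply, hx₀x]
      · rw [← Scheme.Hom.comp_apply, pullback.lift_snd, hc']
      · exact surjective_residueFieldMap_of_isClosed π fX (projectiveSpace (d + 1) k).hom
          hπ.comp_hom x hxc (by rw [hxv]; exact hvc)
    rw [hval]
    exact hcC

/-- **All fibres of `f = q ∘ pr₂` are geometrically connected — Zariski's connectedness theorem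
applied WITHOUT the general Stein factorisation fact** (`X` normal case of de Jong 1996, 4.12:
"hence all fibres of `f` are geometrically connected"). The local section through `E` makes
`f.fromNormalization` an isomorphism (`isIso_fromNormalization_of_section`), i.e.
`f_* 𝒪_{X'} = 𝒪_{ℙ^d}` (`bijective_app_of_isIso_fromNormalization`); every fibre is then
connected by degeneration along a discrete valuation ring through its base point
(`ZariskiSections.isConnected_preimage_singleton`, with the local sections through every
component, `exists_section_apply_mem_component`), and geometrically connected because it has a
rational point (`ZariskiSections.geometricallyConnected_of_isConnected_of_sections`, Stacks 04KV).
[cite: DeJong1996, 4.12, pp. 68–69] -/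
theorem geometricallyConnected_construction_zariski (hπ : Lemma411Projection fX Z d π (vertex d k))
    [LocallyOfFiniteType fX] {P : Scheme.{u}} {b : P ⟶ Proj (grading (Fin (d + 1 + 1)) k)}
    [IsIntegral P] [IsDominant b] (hb : IsBlowup b (vertexIdealSheaf d k)) [IsIntegral (pullback π b)]
    [IsProper (pullback.snd π b ≫ vertexBlowupProjection b hb)]
    (hproj : IsProjectiveOver (Over.mk ((pullback.snd π b ≫ vertexBlowupProjection b hb) ≫
      toSpec (Fin (d + 1)) k)))
    (hdim : ∀ (y : Proj (grading (Fin (d + 1)) k)), ∀ C ∈ irreducibleComponents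
      ↥((pullback.snd π b ≫ vertexBlowupProjection b hb).fiber y), topologicalKrullDim ↥C = 1)
    (hsurj : Surjective (pullback.snd π b ≫ vertexBlowupProjection b hb)) :
    GeometricallyConnected (pullback.snd π b ≫ vertexBlowupProjection b hb) := by
  -- `f_* 𝒪 = 𝒪`: the section through `E` over `D₊(y₀)` splits the Stein factorisation
  obtain ⟨σ, hσ⟩ := exists_section_construction hπ hb
  haveI : Nonempty (chartι k (0 : Fin (d + 1))).opensRange :=
    ⟨⟨chartι k 0 (PrimeSpectrum.comap (PointBlowup.awayBaseEquiv d k 0).toRingHom ⟨⊥, Ideal.isPrime_bot⟩),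
      _, rfl⟩⟩
  haveI : IsIntegral (Proj (grading (Fin (d + 1)) k)) := Motives.ProjSpace.isIntegral d k
  haveI : IsIso (pullback.snd π b ≫ vertexBlowupProjection b hb).fromNormalization :=
    isIso_fromNormalization_of_section _ (isIntegrallyClosed_stalk_projSpace d k)
      (isAffineOpen_opensRange _) σ hσ
  have hΓ : ∀ V : (Proj (grading (Fin (d + 1)) k)).Opens, IsAffineOpen V →
      Function.Bijective ((pullback.snd π b ≫ vertexBlowupProjection b hb).app V) :=
    fun V hV => bijective_app_of_isIso_fromNormalization _ V hV
  -- connected fibres by degeneration, then geometric connectedness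
  haveI : IsProper (toSpec (Fin (d + 1)) k) := by
    rw [← projectiveSpace_hom_eq_toSpec]
    exact Motives.IsProjectiveOver.isProper (isProjectiveOver_projectiveSpace d k)
  have hconn : ∀ y, _root_.IsConnected ((pullback.snd π b ≫ vertexBlowupProjection b hb) ⁻¹' {y}) := by
    intro y
    refine ZariskiSections.isConnected_preimage_singleton _ (toSpec (Fin (d + 1)) k) hproj hΓ y ?_
      (ZariskiSections.exists_dvr_through_point_projectiveSpace d y)
      (fun C hC => exists_section_apply_mem_component hπ hb hdim y hC)
    obtain ⟨x, hx⟩ := hsurj.surj y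
    exact ⟨x, hx⟩
  refine ZariskiSections.geometricallyConnected_of_isConnected_of_sections _ hconn fun y => ?_
  obtain ⟨x, hx⟩ := hsurj.surj y
  obtain ⟨V, hyV, σ, hσ, -⟩ := exists_section_apply_mem_component hπ hb hdim y
    (irreducibleComponent_mem_irreducibleComponents
      (⟨x, hx⟩ : ↥((pullback.snd π b ≫ vertexBlowupProjection b hb) ⁻¹' {y})))
  exact ⟨V, hyV, σ, hσ⟩

end DeJong1996

/-! ## 4.11–4.12 from `DeJong1996Lemma411VertexChoice` ALONE -/

/-- **`DeJong1996FibrationReduction` (Lemma 4.11 with 4.12) from the generic choice of `π`, `p`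
(`DeJong1996Lemma411VertexChoice`) alone** — the proof of
`DeJong1996FibrationReduction.of_vertexChoice_of_stein` with the geometric connectedness of the
fibres of `f` now PROVED (`DeJong1996.geometricallyConnected_construction_zariski`) instead of
taken from the named fact `steinFactorization_geometricallyConnected`.
[cite: DeJong1996, Lemma 4.11 and 4.12, pp. 67–69] -/
theorem DeJong1996FibrationReduction.of_vertexChoice (hC : DeJong1996Lemma411VertexChoice.{u}) :
    DeJong1996FibrationReduction.{u} := by
  intro k _ _ X fX Z hP h1
  haveI := hP.isIntegral
  haveI := hP.isProper
  haveI : IsLocallyNoetherian X := LocallyOfFiniteType.isLocallyNoetherian fX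
  haveI : CompactSpace X := QuasiCompact.compactSpace_of_compactSpace fX
  obtain ⟨d, hd⟩ := exists_nat_topologicalKrullDim_eq_succ fX h1
  -- Lemma 4.11 via the construction, with the blow-up of the vertex built in the tree
  obtain ⟨π, hπ, hcd⟩ := hC k X fX Z d inferInstance hP.isProjectiveOver hP.exists_isEffectiveCartier hd
  obtain ⟨P, b, hb⟩ := exists_isBlowup (Proj (grading (Fin (d + 1 + 1)) k)) (DeJong1996.vertexIdealSheaf d k)
  haveI := DeJong1996.isIntegral_of_isBlowup_vertex hb
  haveI := DeJong1996.isDominant_of_isBlowup_vertex hb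
  have hM := DeJong1996.pointBlowupProjection_vertexBlowupProjection b hb
  obtain ⟨hc, hdd⟩ := hcd P b (DeJong1996.vertexBlowupProjection b hb) hM
    (DeJong1996.isVertexProjection_vertexBlowupProjection b hb)
  have hF : DeJong1996.IsLemma411Fibration fX Z d (pullback.fst π b)
      (pullback.snd π b ≫ DeJong1996.vertexBlowupProjection b hb) :=
    DeJong1996.isLemma411Fibration_of_blowup_of_fibreDimension_of_smoothLocusDense
      DeJong1996Lemma411Blowup_holds DeJong1996Lemma411FibreDimension_holds
      DeJong1996Lemma411SmoothLocusDense_holds hP.isProjectiveOver hd hπ hM hc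
  have hy := hdd hP.isIntegrallyClosed
  set X' := pullback π b
  set φ := pullback.fst π b
  set f := pullback.snd π b ≫ DeJong1996.vertexBlowupProjection b hb
  obtain ⟨S, hS', hSf, hSc, hSreg, -, hblow⟩ := hF.exists_isBlowup
  have hJ := vanishingIdeal_ne_bot_of_forall_isClosed h1 hS' hSc
  have hφ : IsAlteration φ := isAlteration_of_isBlowup hblow hJ
  haveI := hφ.isIntegral
  haveI := hφ.isProper
  haveI := hφ.isDominant
  -- (iii) for `X'`: blow-ups are projective
  have hprojX' : IsProjectiveOver (Over.mk (φ ≫ fX)) :=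
    BlowupProjectiveOverField_holds k X X' fX _ φ inferInstance hP.isProjectiveOver hJ hblow
  -- 4.12: `f` is smooth over a non-empty open (2.8), and its fibres are geometrically connected
  obtain ⟨V, hVne, hVsm⟩ := DeJong1996SmoothOverOpen_holds k X fX Z d X' φ f hP hd hF hy
  have hconn : GeometricallyConnected f := by
    haveI : IsProper f := hF.isProper hP hd
    have ecomp : f ≫ toSpec (Fin (d + 1)) k = φ ≫ fX := by
      rw [← projectiveSpace_hom_eq_toSpec]; exact hF.comp_hom
    have hproj : IsProjectiveOver (Over.mk (f ≫ toSpec (Fin (d + 1)) k)) := by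
      rw [ecomp]; exact hprojX'
    exact DeJong1996.geometricallyConnected_construction_zariski hπ hb hproj
      hF.topologicalKrullDim_eq_one hF.surjective
  haveI := isIntegral_projectiveSpace (n := d) (k := k)
  have hη : genericPoint (projectiveSpace d k).left ∈ V :=
    ((genericPoint_spec (projectiveSpace d k).left).mem_open_set_iff V.isOpen).mpr
      (by simpa using hVne)
  haveI : Smooth (f ∣_ V) := hVsm
  refine ⟨X', φ, hφ, isGenericallyEtale_of_isBlowup hblow, ?_, ?_⟩
  · -- (iii), (iv), (v) for `(X', φ⁻¹ Z)`: blow-ups are projective, 4.10, "`X'` is normal also"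
    obtain ⟨D, hD, hDZ⟩ := hP.exists_isEffectiveCartier
    exact
      { isIntegral := inferInstance
        isProjectiveOver := hprojX'
        exists_isEffectiveCartier := ⟨D.comap φ, hD.comap_of_isDominant φ, by
          rw [Scheme.IdealSheafData.support_comap, TopologicalSpace.Closeds.coe_preimage, hDZ]⟩
        isIntegrallyClosed := fun x' => hblow.isIntegrallyClosed_stalk_of_finite
          (isOpen_regularLocus_of_locallyOfFiniteType_perfectField fX) hP.isIntegrallyClosed hS'
          hSf hSc hSreg x' }
  · -- (vi) a)–d) for `f : X' → ℙ^d`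
    exact ⟨(projectiveSpace d k).left, inferInstance, (projectiveSpace d k).hom, f,
      isProjectiveOver_projectiveSpace d k, hF.comp_hom,
      { locallyOfFinitePresentation := hF.locallyOfFinitePresentation
        surjective := hF.surjective
        geometricallyConnected := hconn
        topologicalKrullDim_eq_one := hF.topologicalKrullDim_eq_one
        dense_preimage_smoothLocus := hF.dense_preimage_smoothLocus
        smooth_fiberToSpecResidueField_genericPoint :=
          smooth_fiberToSpecResidueField_of_mem f V hη },
      hF.isFiniteGenericallyEtaleOn⟩

/-! ## Thm. 4.1 over algebraically closed fields from SIX open leaves -/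

/-- **4.11–4.28 (`DeJong1996NormalProjectiveStep`) from six open leaves**: 4.11–4.12 from the
vertex choice ALONE (`DeJong1996FibrationReduction.of_vertexChoice`), 4.13–4.22 from its printed
leaves with 4.16 discharged (`DeJong1996GaloisNormalization_holds`) and 4.18–4.21 from
Raynaud–Gruson (`DeJong1996RationalMapExtension.of_stacks081R`), 4.23–4.28 from its two open
leaves, 2.23/3.3 being discharged (`DeJong1996NodeLocalStructure_holds`).
[cite: DeJong1996, 4.11–4.28, pp. 67–76] -/
theorem DeJong1996NormalProjectiveStep.of_openLeaves₆
    -- 4.11–4.12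
    (hC : DeJong1996Lemma411VertexChoice.{u})
    -- 4.13–4.22
    (h13 : DeJong1996MultisectionHyperplane.{u})
    (h17 : DeJong1996StableExtension.{u}) (h081R : Stacks081R.{u})
    -- 4.23–4.28
    (hN₂ : DeJong1996NodeLocalStructureCodimTwo.{u}) (hK : DeJong1996SemiStableCodimTwoBlowupCore.{u}) :
    DeJong1996NormalProjectiveStep.{u} :=
  DeJong1996NormalProjectiveStep.of_threeBlocks
    (DeJong1996FibrationReduction.of_vertexChoice hC)
    (DeJong1996FibrationToSemiStablePair.of_printedLeaves h13 DeJong1996GaloisNormalization_holds h17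
      (DeJong1996RationalMapExtension.of_stacks081R h081R))
    (DeJong1996SemiStablePairResolution.of_openLeaves DeJong1996NodeLocalStructure_holds hN₂ hK
      DeJong1996NodalBlowupSingularLocus_holds)

/-- **Thm. 4.1 with its generically-étale clause over algebraically closed fields
(`DeJong1996StrongAlgClosed`) from six open leaves.** [cite: DeJong1996, Thm. 4.1 and 4.3–4.28, pp. 66–76] -/
theorem DeJong1996StrongAlgClosed.of_openLeaves₆
    (hC : DeJong1996Lemma411VertexChoice.{u}) (h13 : DeJong1996MultisectionHyperplane.{u})
    (h17 : DeJong1996StableExtension.{u}) (h081R : Stacks081R.{u})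
    (hN₂ : DeJong1996NodeLocalStructureCodimTwo.{u}) (hK : DeJong1996SemiStableCodimTwoBlowupCore.{u}) :
    DeJong1996StrongAlgClosed.{u} :=
  DeJong1996StrongAlgClosed.of_step
    (DeJong1996NormalProjectiveStep.of_openLeaves₆ hC h13 h17 h081R hN₂ hK)

/-- … and Thm. 4.1 (i)+(ii) over every field (`DeJong1996Strong`), its last sentence over
perfect fields, (i) alone and the weak form, from the same six leaves.
[cite: DeJong1996, Thm. 4.1, p. 66] -/
theorem DeJong1996Strong.of_openLeaves₆
    (hC : DeJong1996Lemma411VertexChoice.{u}) (h13 : DeJong1996MultisectionHyperplane.{u})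
    (h17 : DeJong1996StableExtension.{u}) (h081R : Stacks081R.{u})
    (hN₂ : DeJong1996NodeLocalStructureCodimTwo.{u}) (hK : DeJong1996SemiStableCodimTwoBlowupCore.{u}) :
    DeJong1996Strong.{u} ∧ DeJong1996StrongPerfect.{u} ∧ DeJong1996Projective.{u} ∧ DeJong1996.{u} :=
  have h := DeJong1996Descent_holds
    (DeJong1996StrongAlgClosed.of_openLeaves₆ hC h13 h17 h081R hN₂ hK)
  ⟨h.1, h.2, h.1.projective, h.1.deJong1996⟩

end Literature.AlgebraicGeometry.Resolution

end
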